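import Mathlib
import Summits.Ventures.HodgeRepro2.Tier7.Line3.OneVectorProjectorRange
import Summits.Ventures.HodgeRepro2.Tier7.Line3.InvariantProjector

/-!
# Tier7/Line3/ProductProjector — commuting integrated forms, and `R(f_{ι₁}) R(f_fin)` as ONE orthogonal projection
(seat t7-L1-p2, gen 3)

LINE 3 (t7-plan-3), version (ii), memo v14 §2e (b): `R(f) = R(f_{ι₂}) R(f_{ι₃}) R(f_{ι₁}) R(f_fin)` — a product of
integrated forms of test functions on DIFFERENT factors of the group, acting by commuting operators. THIS FILE:

* **`integratedForm_comm`**: for two unitary, strongly continuous representations `π₁`, `π₂` of compact groups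
  `G₁`, `G₂` on the same Hilbert space `H` whose operators commute (`π₁ g (π₂ k x) = π₂ k (π₁ g x)`), the integrated
  forms commute: `R₁(f₁) (R₂(f₂) x) = R₂(f₂) (R₁(f₁) x)` — proved by passing the bounded operator `R₁(f₁)` through
  the integral defining `R₂(f₂)` (no Fubini, no product σ-algebra); `commute_integratedFormCLM`;
* `range_mul_eq_inf`: for commuting idempotent bounded operators, `range (P Q) = range P ⊓ range Q`;
* **`isStarProjection_Rop_mul_avgCLM`** and **`range_Rop_mul_avgCLM`**: the product `R(f_{ι₁}) ∘ R(f_fin)` of the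
  one-vector projector (p677826 / p679xxx `OneVectorProjectorRange`) and the invariant projector (p679097
  `InvariantProjector`) is a star projection (Mathlib's `IsStarProjection.mul` for commuting star projections)
  whose range is EXACTLY `uImages ⊓ fixed` — the `u`-vectors of the embedded copies of `τ` that are `K`-invariant —
  so `R(f_{ι₁}) R(f_fin)` IS the orthogonal projection onto that subspace (`starProjection_inf_apply`).

The finite-dimensionality of that subspace for the real objects (level-`K_f` forms of prescribed archimedean type;
GH Thm 18.2.2 / DE 9.2.2) stays printed; the dictionary (`U(W_A)(F_{ι₁})` and `K_f` acting on `L²([G])` by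
commuting right translations) is in words. Nothing here is about (N). No sorry; axioms ⊆ {propext,
Classical.choice, Quot.sound}.
-/

namespace Summit.Ventures.HodgeRepro2.Tier7.Line3.ProductProjector

open MeasureTheory
open scoped InnerProductSpace
open Summit.Ventures.HodgeRepro2.T7SupportIntegratedForm (integratedForm integratedFormCLM integratedFormCLM_apply
  IsStronglyMeasurable integrable_smul)
open Summit.Ventures.HodgeRepro2.Tier7.Line3.SchurProjector (IsIrreducible)
open Summit.Ventures.HodgeRepro2.Tier7.Line3.OneVectorProjector
open Summit.Ventures.HodgeRepro2.Tier7.Line3.OneVectorProjectorRange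
open Summit.Ventures.HodgeRepro2.Tier7.Line3.InvariantProjector

section Commute

variable {G₁ : Type*} [Group G₁] [TopologicalSpace G₁] [IsTopologicalGroup G₁] [CompactSpace G₁]
  [MeasurableSpace G₁] [BorelSpace G₁] (μ₁ : Measure G₁)
variable {G₂ : Type*} [Group G₂] [TopologicalSpace G₂] [IsTopologicalGroup G₂] [CompactSpace G₂]
  [MeasurableSpace G₂] [BorelSpace G₂] (μ₂ : Measure G₂)
variable {H : Type*} [NormedAddCommGroup H] [InnerProductSpace ℂ H] [CompleteSpace H]

omit [IsTopologicalGroup G₁] [TopologicalSpace G₂] [IsTopologicalGroup G₂] [CompactSpace G₂] [MeasurableSpace G₂]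
  [BorelSpace G₂] in
/-- `R₁(f₁)` commutes with every `π₂ k` when the two representations commute. -/
theorem integratedForm_pi [IsFiniteMeasure μ₁] {π₁ : G₁ →* (H →ₗ[ℂ] H)} (hπ₁ : T7SupportWeightTorusOrbital.IsUnitaryRep π₁)
    (hc₁ : ∀ x, Continuous fun g => π₁ g x) {f₁ : G₁ → ℂ} (hf₁ : Continuous f₁) {π₂ : G₂ →* (H →ₗ[ℂ] H)}
    (hπ₂ : T7SupportWeightTorusOrbital.IsUnitaryRep π₂) (hcomm : ∀ g k x, π₁ g (π₂ k x) = π₂ k (π₁ g x)) (k : G₂)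
    (x : H) : integratedForm μ₁ π₁ f₁ (π₂ k x) = π₂ k (integratedForm μ₁ π₁ f₁ x) := by
  unfold integratedForm
  have hint : Integrable (fun g => f₁ g • π₁ g x) μ₁ :=
    integrable_smul μ₁ hπ₁ (OneVectorProjector.isStronglyMeasurable_of_continuous μ₁ hc₁)
      (hf₁.integrable_of_hasCompactSupport (HasCompactSupport.of_compactSpace _)) x
  conv_rhs => rw [← OneVectorProjector.piCLM_apply π₂ hπ₂ k]
  rw [← ContinuousLinearMap.integral_comp_comm _ hint]
  congr 1
  funext g
  rw [map_smul, OneVectorProjector.piCLM_apply, hcomm]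

omit [IsTopologicalGroup G₁] [IsTopologicalGroup G₂] in
/-- **commuting integrated forms**: `R₁(f₁) (R₂(f₂) x) = R₂(f₂) (R₁(f₁) x)` (the bounded operator `R₁(f₁)` passes
through the integral defining `R₂(f₂)`; no Fubini). -/
theorem integratedForm_comm [IsFiniteMeasure μ₁] [IsFiniteMeasure μ₂] {π₁ : G₁ →* (H →ₗ[ℂ] H)}
    (hπ₁ : T7SupportWeightTorusOrbital.IsUnitaryRep π₁) (hc₁ : ∀ x, Continuous fun g => π₁ g x) {f₁ : G₁ → ℂ}
    (hf₁ : Continuous f₁) {π₂ : G₂ →* (H →ₗ[ℂ] H)} (hπ₂ : T7SupportWeightTorusOrbital.IsUnitaryRep π₂)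
    (hc₂ : ∀ x, Continuous fun k => π₂ k x) {f₂ : G₂ → ℂ} (hf₂ : Continuous f₂)
    (hcomm : ∀ g k x, π₁ g (π₂ k x) = π₂ k (π₁ g x)) (x : H) :
    integratedForm μ₁ π₁ f₁ (integratedForm μ₂ π₂ f₂ x) = integratedForm μ₂ π₂ f₂ (integratedForm μ₁ π₁ f₁ x) := by
  have hm₁ := OneVectorProjector.isStronglyMeasurable_of_continuous μ₁ hc₁
  have hi₁ : Integrable f₁ μ₁ := hf₁.integrable_of_hasCompactSupport (HasCompactSupport.of_compactSpace _)
  have hint₂ : Integrable (fun k => f₂ k • π₂ k x) μ₂ :=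
    integrable_smul μ₂ hπ₂ (OneVectorProjector.isStronglyMeasurable_of_continuous μ₂ hc₂)
      (hf₂.integrable_of_hasCompactSupport (HasCompactSupport.of_compactSpace _)) x
  have e1 : integratedForm μ₁ π₁ f₁ (integratedForm μ₂ π₂ f₂ x) =
      integratedFormCLM μ₁ hπ₁ hm₁ hi₁ (∫ k, f₂ k • π₂ k x ∂μ₂) := rfl
  rw [e1, ← ContinuousLinearMap.integral_comp_comm _ hint₂]
  show (∫ k, integratedFormCLM μ₁ hπ₁ hm₁ hi₁ (f₂ k • π₂ k x) ∂μ₂) = ∫ k, f₂ k • π₂ k (integratedForm μ₁ π₁ f₁ x) ∂μ₂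
  congr 1
  funext k
  rw [map_smul, integratedFormCLM_apply, integratedForm_pi μ₁ hπ₁ hc₁ hf₁ hπ₂ hcomm k x]

omit [IsTopologicalGroup G₁] [IsTopologicalGroup G₂] in
/-- the bounded operators commute. -/
theorem commute_integratedFormCLM [IsFiniteMeasure μ₁] [IsFiniteMeasure μ₂] {π₁ : G₁ →* (H →ₗ[ℂ] H)}
    (hπ₁ : T7SupportWeightTorusOrbital.IsUnitaryRep π₁) (hc₁ : ∀ x, Continuous fun g => π₁ g x) {f₁ : G₁ → ℂ}
    (hf₁ : Continuous f₁) {π₂ : G₂ →* (H →ₗ[ℂ] H)} (hπ₂ : T7SupportWeightTorusOrbital.IsUnitaryRep π₂)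
    (hc₂ : ∀ x, Continuous fun k => π₂ k x) {f₂ : G₂ → ℂ} (hf₂ : Continuous f₂)
    (hcomm : ∀ g k x, π₁ g (π₂ k x) = π₂ k (π₁ g x)) :
    Commute (integratedFormCLM μ₁ hπ₁ (OneVectorProjector.isStronglyMeasurable_of_continuous μ₁ hc₁)
        (hf₁.integrable_of_hasCompactSupport (HasCompactSupport.of_compactSpace _)))
      (integratedFormCLM μ₂ hπ₂ (OneVectorProjector.isStronglyMeasurable_of_continuous μ₂ hc₂)
        (hf₂.integrable_of_hasCompactSupport (HasCompactSupport.of_compactSpace _))) := by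
  refine ContinuousLinearMap.ext fun x => ?_
  exact integratedForm_comm μ₁ μ₂ hπ₁ hc₁ hf₁ hπ₂ hc₂ hf₂ hcomm x

end Commute

section Range

variable {H : Type*} [NormedAddCommGroup H] [InnerProductSpace ℂ H]

/-- **the range of a product of commuting idempotents is the intersection of the ranges**. -/
theorem range_mul_eq_inf {P Q : H →L[ℂ] H} (hP : IsIdempotentElem P) (hQ : IsIdempotentElem Q)
    (hPQ : Commute P Q) :
    LinearMap.range ((P * Q : H →L[ℂ] H) : H →ₗ[ℂ] H) =
      LinearMap.range (P : H →ₗ[ℂ] H) ⊓ LinearMap.range (Q : H →ₗ[ℂ] H) := by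
  have hPx : ∀ x, P (P x) = P x := fun x => congrArg (fun T : H →L[ℂ] H => T x) hP
  have hQx : ∀ x, Q (Q x) = Q x := fun x => congrArg (fun T : H →L[ℂ] H => T x) hQ
  have hc : ∀ x, P (Q x) = Q (P x) := fun x => congrArg (fun T : H →L[ℂ] H => T x) hPQ.eq
  ext y
  simp only [Submodule.mem_inf, LinearMap.mem_range, ContinuousLinearMap.coe_coe, ContinuousLinearMap.mul_def,
    ContinuousLinearMap.comp_apply]
  constructor
  · rintro ⟨x, rfl⟩
    exact ⟨⟨Q x, rfl⟩, ⟨P x, (hc x).symm⟩⟩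
  · rintro ⟨⟨a, rfl⟩, ⟨b, hb⟩⟩
    refine ⟨P a, ?_⟩
    rw [← hb, hQx, hb, hPx]

end Range

section Composite

variable {G : Type*} [Group G] [TopologicalSpace G] [IsTopologicalGroup G] [CompactSpace G]
  [MeasurableSpace G] [BorelSpace G] (μ : Measure G)
variable {K : Type*} [Group K] [TopologicalSpace K] [IsTopologicalGroup K] [CompactSpace K]
  [MeasurableSpace K] [BorelSpace K] (ν : Measure K)
variable {V : Type*} [NormedAddCommGroup V] [InnerProductSpace ℂ V] [FiniteDimensional ℂ V] [CompleteSpace V]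
variable {H : Type*} [NormedAddCommGroup H] [InnerProductSpace ℂ H] [CompleteSpace H]

/-- **`R(f_{ι₁}) ∘ R(f_fin)` is a star projection** (commuting star projections). -/
theorem isStarProjection_Rop_mul_avgCLM [μ.IsHaarMeasure] [IsProbabilityMeasure μ] [ν.IsHaarMeasure]
    [IsProbabilityMeasure ν] {τ : G →* (V →L[ℂ] V)} (hτ : Continuous τ) (hτu : SchurProjector.IsUnitaryRep τ)
    (hτi : IsIrreducible τ) {π : G →* (H →ₗ[ℂ] H)} (hπ : T7SupportWeightTorusOrbital.IsUnitaryRep π)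
    (hc : ∀ x, Continuous fun g => π g x) (u : V) (hu : ⟪u, u⟫_ℂ = 1) {ρ : K →* (H →ₗ[ℂ] H)}
    (hρ : T7SupportWeightTorusOrbital.IsUnitaryRep ρ) (hcρ : ∀ x, Continuous fun k => ρ k x)
    (hcomm : ∀ g k x, π g (ρ k x) = ρ k (π g x)) :
    IsStarProjection (Rop μ hτ hπ hc u * avgCLM ν hρ hcρ) :=
  IsStarProjection.mul (isStarProjection_Rop μ hτ hτu hτi hπ hc u hu) (isStarProjection_avgCLM ν hρ hcρ)
    (commute_integratedFormCLM μ ν hπ hc (continuous_mc hτ u u) hρ hcρ continuous_const hcomm)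

/-- **the range of `R(f_{ι₁}) ∘ R(f_fin)` is `uImages ⊓ fixed`**: the `u`-vectors of the embedded copies of `τ` that
are `K`-invariant. -/
theorem range_Rop_mul_avgCLM [IsProbabilityMeasure μ] [μ.IsMulLeftInvariant] [IsProbabilityMeasure ν]
    [ν.IsMulLeftInvariant] {τ : G →* (V →L[ℂ] V)} (hτ : Continuous τ) (hτu : SchurProjector.IsUnitaryRep τ)
    (hτi : IsIrreducible τ) {π : G →* (H →ₗ[ℂ] H)} (hπ : T7SupportWeightTorusOrbital.IsUnitaryRep π)
    (hc : ∀ x, Continuous fun g => π g x) (u : V) (hu : ⟪u, u⟫_ℂ = 1) {ρ : K →* (H →ₗ[ℂ] H)}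
    (hρ : T7SupportWeightTorusOrbital.IsUnitaryRep ρ) (hcρ : ∀ x, Continuous fun k => ρ k x)
    (hcomm : ∀ g k x, π g (ρ k x) = ρ k (π g x)) :
    LinearMap.range ((Rop μ hτ hπ hc u * avgCLM ν hρ hcρ : H →L[ℂ] H) : H →ₗ[ℂ] H) =
      uImages μ hτ hτu hτi hπ hc u hu ⊓ fixed ρ := by
  rw [range_mul_eq_inf (isIdempotentElem_Rop μ hτ hτu hτi hπ hc u hu) (isIdempotentElem_avgCLM ν hρ hcρ)
    (commute_integratedFormCLM μ ν hπ hc (continuous_mc hτ u u) hρ hcρ continuous_const hcomm),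
    range_Rop_eq μ hτ hτu hτi hπ hc u hu, range_avgCLM_eq_fixed ν hρ hcρ]

/-- `uImages ⊓ fixed` has an orthogonal projection. -/
theorem hasOrthogonalProjection_inf [μ.IsHaarMeasure] [IsProbabilityMeasure μ] [ν.IsHaarMeasure]
    [IsProbabilityMeasure ν] {τ : G →* (V →L[ℂ] V)} (hτ : Continuous τ) (hτu : SchurProjector.IsUnitaryRep τ)
    (hτi : IsIrreducible τ) {π : G →* (H →ₗ[ℂ] H)} (hπ : T7SupportWeightTorusOrbital.IsUnitaryRep π)
    (hc : ∀ x, Continuous fun g => π g x) (u : V) (hu : ⟪u, u⟫_ℂ = 1) {ρ : K →* (H →ₗ[ℂ] H)}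
    (hρ : T7SupportWeightTorusOrbital.IsUnitaryRep ρ) (hcρ : ∀ x, Continuous fun k => ρ k x)
    (hcomm : ∀ g k x, π g (ρ k x) = ρ k (π g x)) :
    (uImages μ hτ hτu hτi hπ hc u hu ⊓ fixed ρ).HasOrthogonalProjection := by
  rw [← range_Rop_mul_avgCLM μ ν hτ hτu hτi hπ hc u hu hρ hcρ hcomm]
  exact ContinuousLinearMap.IsIdempotentElem.hasOrthogonalProjection_range
    (isStarProjection_Rop_mul_avgCLM μ ν hτ hτu hτi hπ hc u hu hρ hcρ hcomm).isIdempotentElem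

omit [IsTopologicalGroup G] [IsTopologicalGroup K] [FiniteDimensional ℂ V] [CompleteSpace V] [CompleteSpace H] in
/-- `(R(f_{ι₁}) ∘ R(f_fin)) x = R(f_{ι₁}) (R(f_fin) x)`. -/
theorem Rop_mul_avgCLM_apply [IsFiniteMeasure μ] [IsFiniteMeasure ν] {τ : G →* (V →L[ℂ] V)} (hτ : Continuous τ)
    {π : G →* (H →ₗ[ℂ] H)} (hπ : T7SupportWeightTorusOrbital.IsUnitaryRep π) (hc : ∀ x, Continuous fun g => π g x)
    (u : V) {ρ : K →* (H →ₗ[ℂ] H)} (hρ : T7SupportWeightTorusOrbital.IsUnitaryRep ρ)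
    (hcρ : ∀ x, Continuous fun k => ρ k x) (x : H) :
    (Rop μ hτ hπ hc u * avgCLM ν hρ hcρ) x = Rop μ hτ hπ hc u (avgCLM ν hρ hcρ x) := rfl

/-- **`(R(f_{ι₁}) ∘ R(f_fin)) x` is the orthogonal projection of `x` onto `uImages ⊓ fixed`**. -/
theorem starProjection_inf_apply [μ.IsHaarMeasure] [IsProbabilityMeasure μ] [ν.IsHaarMeasure]
    [IsProbabilityMeasure ν] {τ : G →* (V →L[ℂ] V)} (hτ : Continuous τ) (hτu : SchurProjector.IsUnitaryRep τ)
    (hτi : IsIrreducible τ) {π : G →* (H →ₗ[ℂ] H)} (hπ : T7SupportWeightTorusOrbital.IsUnitaryRep π)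
    (hc : ∀ x, Continuous fun g => π g x) (u : V) (hu : ⟪u, u⟫_ℂ = 1) {ρ : K →* (H →ₗ[ℂ] H)}
    (hρ : T7SupportWeightTorusOrbital.IsUnitaryRep ρ) (hcρ : ∀ x, Continuous fun k => ρ k x)
    (hcomm : ∀ g k x, π g (ρ k x) = ρ k (π g x)) (x : H) :
    haveI := hasOrthogonalProjection_inf μ ν hτ hτu hτi hπ hc u hu hρ hcρ hcomm
    (uImages μ hτ hτu hτi hπ hc u hu ⊓ fixed ρ).starProjection x = (Rop μ hτ hπ hc u * avgCLM ν hρ hcρ) x := by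
  haveI := hasOrthogonalProjection_inf μ ν hτ hτu hτi hπ hc u hu hρ hcρ hcomm
  have hsp := isStarProjection_Rop_mul_avgCLM μ ν hτ hτu hτi hπ hc u hu hρ hcρ hcomm
  have hsym := hsp.isSelfAdjoint.isSymmetric
  have hidem : ∀ y, (Rop μ hτ hπ hc u * avgCLM ν hρ hcρ) ((Rop μ hτ hπ hc u * avgCLM ν hρ hcρ) y) =
      (Rop μ hτ hπ hc u * avgCLM ν hρ hcρ) y :=
    fun y => congrArg (fun T : H →L[ℂ] H => T y) hsp.isIdempotentElem
  refine Submodule.eq_starProjection_of_mem_orthogonal ?_ ?_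
  · rw [← range_Rop_mul_avgCLM μ ν hτ hτu hτi hπ hc u hu hρ hcρ hcomm]
    exact LinearMap.mem_range_self _ x
  · rw [← range_Rop_mul_avgCLM μ ν hτ hτu hτi hπ hc u hu hρ hcρ hcomm, Submodule.mem_orthogonal]
    rintro y ⟨z, rfl⟩
    have h := hsym ((Rop μ hτ hπ hc u * avgCLM ν hρ hcρ) z) x
    simp only [ContinuousLinearMap.coe_coe] at h ⊢
    rw [inner_sub_right, ← h, hidem, sub_self]

end Composite

end Summit.Ventures.HodgeRepro2.Tier7.Line3.ProductProjector
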